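import Summits.Ventures.YMGap.RobustBall.PerturbedAxisCovariance
import Summits.Ventures.YMGap.RobustBall.OneStateInvariantPairs
import HarnessLib

/-!
# Venture YMGap, track ROBUST-BALL — ONE STATE, step 14: axis permutations for the TIER-2 carrier and for the
# infinite-range isotropic two-plaquette member

HONEST FRAMING. WHAT THIS IS: a venture file (cell `pub-ymgap`, track Y2 ROBUST-BALL, seat ds-3) continuing
`PerturbedAxisCovariance.lean`: (i) the tier-2 perturbed specification `perturbedYMS ρ β W` (link-summable, possibly
infinite-range `W`) is covariant under an axis permutation `π` for every `π`-covariant potential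
`W_{πX}(configPermZd π U) = W_X(U)` (`perturbedEnergyS_perm`, `perturbedYMS_map_configPermZd`), hence ★ its one state is
`π`-invariant in the uniqueness regime (`oneState_permInvariant_of_perturbedMassGapAtS`) — no Van Hove join needed; (ii) a
generic re-indexing lemma for rb-p1's indexed potentials under a relabelling of the links (`indexedPotential_relabel`);
(iii) the two-plaquette couplings `plaqPairCoupling N J` are `π`-covariant whenever `J` depends on the pair only through data
preserved by the permutation of base points (`plaqPairCoupling_perm`), in particular the ISOTROPIC member `J = τ κ^{‖x_p − x_q‖₁}`
(`l1_sitePermZd`, `isotropicPairWitness_perm`); ★★ cells: the unique DLR state of `SU(2)` Wilson on `ℤ⁴` at `β_W = 1/16` plus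
ALL plaquette-pair couplings `τ (1/10)^{‖x_p−x_q‖₁}(Re tr U_p/2)(Re tr U_q/2)`, `|τ| ≤ 1/10000`, is invariant under ALL 24 AXIS
PERMUTATIONS (`su2_isotropicPair_oneState_permInvariant`), and the every-`N` twin at 't Hooft `1/64`, `|τ| ≤ 1/12000`
(`suN_isotropicPair_oneState_permInvariant`) — on top of translation invariance (`OneStateInvariantPairs.lean`).
WHAT THIS IS NOT: reflections are not treated; lattice strong-coupling statements; nothing about the continuum limit or
the Clay Millennium problem.

References: H.-O. Georgii (2011), §5.1; the tree's `WilsonAxisSymmetry.lean`; the track's `PerturbedAxisCovariance.lean`,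
`SummableSpecification.lean`, `PairCoupling(Geometry).lean`, `IsotropicPairWitness.lean`, `LatticeSumL1.lean`.
-/

noncomputable section

open MeasureTheory Filter Function Finset
open Literature.Probability.LatticeModels hiding configShift configShift_apply
open Literature.MathematicalPhysics.QuantumLattice
open Literature.MathematicalPhysics.QuantumFieldTheory hiding ZdEdge Site

namespace Summit.Ventures.YMGap.RobustBall

/-! ### The tier-2 carrier under axis permutations -/

section CarrierS

variable {d N : ℕ} {G : Type*} [Group G] (ρ : G →* Matrix (Fin N) (Fin N) ℂ)
  [TopologicalSpace G] [IsTopologicalGroup G] [CompactSpace G] [MeasurableSpace G]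

/-- **Axis-permutation covariance of the tier-2 perturbed energy** for a `π`-covariant potential (the series over all finite
link sets meeting the volume is re-indexed along `X ↦ πX`). [folklore] -/
theorem perturbedEnergyS_perm (hρ : Continuous ρ) (β : ℝ) {W : Potential (ZdEdge d) G} (π : Equiv.Perm (Fin d))
    (hW : ∀ (X : Finset (ZdEdge d)) (U : LGConfig d G), W (X.map (edgePermZd π).toEmbedding) (configPermZd π U) = W X U)
    (Λ : Finset (ZdEdge d)) (U : LGConfig d G) :
    perturbedEnergyS ρ β W (Λ.map (edgePermZd π).toEmbedding) (configPermZd π U) = perturbedEnergyS ρ β W Λ U := by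
  classical
  simp only [perturbedEnergyS, wilsonBoundaryAction_perm ρ hρ]
  congr 1
  rw [← (Equiv.finsetCongr (edgePermZd π)).tsum_eq]
  refine tsum_congr fun X => ?_
  simp only [Equiv.finsetCongr_apply, ← Finset.map_inter, Finset.map_nonempty, hW]

variable [BorelSpace G] [SecondCountableTopology G]

/-- ★ **Axis-permutation covariance of the tier-2 perturbed specification** (link-summable `π`-covariant potential with
continuous terms). [folklore] -/
theorem perturbedYMS_map_configPermZd (hρ : Continuous ρ) (β : ℝ) {W : Potential (ZdEdge d) G}
    {B : Finset (ZdEdge d) → ℝ} (hB : IsLinkSummable W B) (hWc : ∀ X, Continuous (W X)) (π : Equiv.Perm (Fin d))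
    (hW : ∀ (X : Finset (ZdEdge d)) (U : LGConfig d G), W (X.map (edgePermZd π).toEmbedding) (configPermZd π U) = W X U)
    (Λ : Finset (ZdEdge d)) (η : LGConfig d G) :
    (perturbedYMS ρ β W Λ η).map (configPermZd π) =
      perturbedYMS ρ β W (Λ.map (edgePermZd π).toEmbedding) (configPermZd π η) :=
  Covariance.tilted_glueWith_map_arrowCongr _ _ (continuous_perturbedEnergyS ρ hρ β hB hWc Λ)
    (continuous_perturbedEnergyS ρ hρ β hB hWc _) Λ (edgePermZd π) (perturbedEnergyS_perm ρ hρ β π hW Λ) η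

/-- ★ **Tier 2: the image of a DLR state of a `π`-covariant member under `π` is a DLR state.** [folklore] -/
theorem map_configPermZd_mem_perturbedGibbsMeasuresS [T2Space G] (hρ : Continuous ρ) (β : ℝ)
    {W : Potential (ZdEdge d) G} {B : Finset (ZdEdge d) → ℝ} (hB : IsLinkSummable W B)
    (hWc : ∀ X, Continuous (W X)) (hdep : ∀ X, DependsOn (W X) (↑X : Set (ZdEdge d))) (π : Equiv.Perm (Fin d))
    (hW : ∀ (X : Finset (ZdEdge d)) (U : LGConfig d G), W (X.map (edgePermZd π).toEmbedding) (configPermZd π U) = W X U)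
    {μ : Measure (LGConfig d G)} (hμ : μ ∈ perturbedGibbsMeasuresS (d := d) ρ β W) :
    μ.map (configPermZd π) ∈ perturbedGibbsMeasuresS (d := d) ρ β W :=
  Covariance.map_arrowCongr_mem_gibbsMeasures (isSpecification_perturbedYMS ρ hρ β hB hWc hdep) (edgePermZd π)
    (fun Λ η => perturbedYMS_map_configPermZd ρ hρ β hB hWc π hW Λ η) hμ

end CarrierS

/-- ★★ **TIER 2: THE ONE STATE OF A `π`-COVARIANT LINK-SUMMABLE MEMBER IS `π`-INVARIANT** (no Van Hove join). [folklore] -/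
theorem oneState_permInvariant_of_perturbedMassGapAtS {d N : ℕ} {β : ℝ} {W : Potential (ZdEdge d) (SUN N)}
    (hgap : PerturbedMassGapAtS d N β W) {B : Finset (ZdEdge d) → ℝ} (hB : IsLinkSummable W B)
    (hWc : ∀ X, Continuous (W X)) (hdep : ∀ X, DependsOn (W X) (↑X : Set (ZdEdge d)))
    (hW : ∀ (π : Equiv.Perm (Fin d)) (X : Finset (ZdEdge d)) (U : LGConfig d (SUN N)),
      W (X.map (edgePermZd π).toEmbedding) (configPermZd π U) = W X U) :
    ∃ μ : Measure (LGConfig d (SUN N)),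
      perturbedGibbsMeasuresS (d := d) (fundamentalRep (Fin N)) ((N : ℝ) * β) W = {μ} ∧
        ∀ π : Equiv.Perm (Fin d), μ.map (configPermZd π) = μ := by
  obtain ⟨hsub, ⟨μ, hμ⟩⟩ := hgap.1
  exact ⟨μ, Set.eq_singleton_iff_unique_mem.2 ⟨hμ, fun ν hν => hsub hν hμ⟩, fun π =>
    hsub (map_configPermZd_mem_perturbedGibbsMeasuresS _ (continuous_fundamentalRep (Fin N)) _ hB hWc hdep π (hW π) hμ)
      hμ⟩

/-! ### Indexed potentials under a relabelling of the links -/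

section Indexed

variable {d N : ℕ}

/-- **An indexed potential with a compatible index map is covariant under a relabelling of the links**: if
`fib (e X) = sh '' fib X`, `sh` is injective and `φ_{sh i}(T U) = φ_i(U)`, then `W_{eX}(T U) = W_X(U)` for
`W = indexedPotential fib φ`. [folklore] -/
theorem indexedPotential_relabel {ι : Type*} {fib : Finset (ZdEdge d) → Finset ι}
    {φ : ι → LGConfig d (Matrix.specialUnitaryGroup (Fin N) ℂ) → ℝ} (e : ZdEdge d ≃ ZdEdge d)
    (T : LGConfig d (Matrix.specialUnitaryGroup (Fin N) ℂ) → LGConfig d (Matrix.specialUnitaryGroup (Fin N) ℂ))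
    (sh : ι → ι) (hfib : ∀ (X : Finset (ZdEdge d)) (i : ι), i ∈ fib (X.map e.toEmbedding) ↔ ∃ j ∈ fib X, sh j = i)
    (hinj : Function.Injective sh)
    (hφ : ∀ (i : ι) (U : LGConfig d (Matrix.specialUnitaryGroup (Fin N) ℂ)), φ (sh i) (T U) = φ i U)
    (X : Finset (ZdEdge d)) (U : LGConfig d (Matrix.specialUnitaryGroup (Fin N) ℂ)) :
    indexedPotential fib φ (X.map e.toEmbedding) (T U) = indexedPotential fib φ X U := by
  classical
  have hset : fib (X.map e.toEmbedding) = (fib X).image sh := by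
    ext i
    rw [hfib, Finset.mem_image]
  rw [indexedPotential_apply, indexedPotential_apply, hset, Finset.sum_image fun j _ k _ h => hinj h]
  exact Finset.sum_congr rfl fun i _ => hφ i U

end Indexed

/-! ### Plaquettes and plaquette pairs under axis permutations -/

section Pairs

variable {d N : ℕ}

/-- **The permuted plaquette, with its base point**: for every plaquette `p` and permutation `π` there is a plaquette `p'`
based at `sitePermZd π p.1` with links `edgePermZd π '' links(p)` and the same normalised observable in the permuted field.
[folklore] -/
theorem exists_plaquette_perm_base (π : Equiv.Perm (Fin d)) (p : ZdPlaquette d) :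
    ∃ p' : ZdPlaquette d, p'.1 = sitePermZd π p.1 ∧ plaquetteEdges p' = (plaquetteEdges p).map (edgePermZd π).toEmbedding ∧
      ∀ U : LGConfig d (Matrix.specialUnitaryGroup (Fin N) ℂ), plaqObsN N p' (configPermZd π U) = plaqObsN N p U := by
  obtain ⟨x, ⟨⟨a, b⟩, hab⟩⟩ := p
  have hab' : a < b := hab
  have hρ : Continuous (fundamentalRep (Fin N)) := continuous_fundamentalRep (Fin N)
  by_cases h : π a < π b
  · refine ⟨(sitePermZd π x, ⟨(π a, π b), h⟩), rfl, plaquetteEdges_perm_of_lt π x hab' h, fun U => ?_⟩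
    simp only [plaqObsN, plaquetteObs_configPermZd, sitePermZd_symm_apply_apply, Equiv.symm_apply_apply]
  · have h' : π b < π a := lt_of_le_of_ne (not_lt.1 h) fun heq => hab'.ne' (π.injective heq)
    refine ⟨(sitePermZd π x, ⟨(π b, π a), h'⟩), rfl, plaquetteEdges_perm_of_gt π x hab' h', fun U => ?_⟩
    simp only [plaqObsN, plaquetteObs_configPermZd, sitePermZd_symm_apply_apply, Equiv.symm_apply_apply]
    rw [plaquetteObs_swap _ hρ x a b U]

/-- ★ **Two-plaquette couplings whose coupling function sees the pair only through the base points, covariantly, are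
axis-permutation covariant**: if `J (p', q') = J (p, q)` whenever `p'.1 = π p.1`, `q'.1 = π q.1`, then
`W_{πX}(configPermZd π U) = W_X(U)` for `W = plaqPairCoupling N J`. [folklore] -/
theorem plaqPairCoupling_perm {J : PlaqPairIdx d → ℝ} (π : Equiv.Perm (Fin d))
    (hJ : ∀ p q p' q' : ZdPlaquette d, p'.1 = sitePermZd π p.1 → q'.1 = sitePermZd π q.1 → J (p', q') = J (p, q))
    (X : Finset (ZdEdge d)) (U : LGConfig d (Matrix.specialUnitaryGroup (Fin N) ℂ)) :
    plaqPairCoupling N J (X.map (edgePermZd π).toEmbedding) (configPermZd π U) = plaqPairCoupling N J X U := by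
  classical
  -- forward and backward permuted plaquettes
  choose f hfb hfe hfo using exists_plaquette_perm_base (N := N) (d := d) π
  choose g _hgb hge _hgo using exists_plaquette_perm_base (N := N) (d := d) π.symm
  have hπinv : (edgePermZd (d := d) π.symm) = (edgePermZd π).symm := rfl
  have hgf : ∀ p, g (f p) = p := fun p =>
    plaquetteEdges_injective (by rw [hge, hfe, hπinv, Covariance.map_map_symm])
  have hfg : ∀ p, f (g p) = p := fun p =>
    plaquetteEdges_injective (by rw [hfe, hge, hπinv, Covariance.map_symm_map])
  have hcode : ∀ i : PlaqPairIdx d, plaqPairCode (f i.1, f i.2) = (plaqPairCode i).map (edgePermZd π).toEmbedding := fun i => by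
    rw [plaqPairCode, plaqPairCode, Finset.map_union, hfe, hfe]
  refine indexedPotential_relabel (edgePermZd π) (configPermZd π) (fun i => (f i.1, f i.2)) (fun X i => ?_)
    (fun j k h => ?_) (fun i U => ?_) X U
  · rw [mem_plaqPairFib]
    constructor
    · intro h
      refine ⟨(g i.1, g i.2), ?_, by simp [hfg]⟩
      rw [mem_plaqPairFib]
      have h2 := hcode (g i.1, g i.2)
      simp only [hfg, Prod.mk.eta] at h2
      rw [h2] at h
      have h3 := congrArg (Finset.map (edgePermZd π).symm.toEmbedding) h
      rwa [Covariance.map_map_symm, Covariance.map_map_symm] at h3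
    · rintro ⟨j, hj, rfl⟩
      rw [mem_plaqPairFib] at hj
      rw [hcode, hj]
  · simp only [Prod.mk.injEq] at h
    exact Prod.ext (by rw [← hgf j.1, ← hgf k.1, h.1]) (by rw [← hgf j.2, ← hgf k.2, h.2])
  · simp only [plaqPairTerm, hfo, hJ i.1 i.2 (f i.1) (f i.2) (hfb i.1) (hfb i.2)]

/-- The `ℓ¹` length of a lattice vector is invariant under permutations of the coordinates. [folklore] -/
theorem l1_sitePermZd (π : Equiv.Perm (Fin d)) (x : Site d) : l1 (sitePermZd π x) = l1 x := by
  unfold l1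
  simp only [sitePermZd_apply]
  exact Equiv.sum_comp π.symm (fun k => (x k).natAbs)

/-- The isotropic couplings are axis-permutation invariant. [folklore] -/
theorem isoJ_perm (τ κ : ℝ) (π : Equiv.Perm (Fin d)) (p q p' q' : ZdPlaquette d) (hp : p'.1 = sitePermZd π p.1)
    (hq : q'.1 = sitePermZd π q.1) : isoJ τ κ (p', q') = isoJ τ κ (p, q) := by
  simp only [isoJ, hp, hq, ← sitePermZd_sub, l1_sitePermZd]

/-- ★ **The isotropic two-plaquette member is axis-permutation covariant.** [folklore] -/
theorem isotropicPairWitness_perm (τ κ : ℝ) (π : Equiv.Perm (Fin d)) (X : Finset (ZdEdge d))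
    (U : LGConfig d (Matrix.specialUnitaryGroup (Fin N) ℂ)) :
    isotropicPairWitness N τ κ (X.map (edgePermZd π).toEmbedding) (configPermZd π U) = isotropicPairWitness N τ κ X U :=
  plaqPairCoupling_perm π (isoJ_perm τ κ π) X U

/-- ★★ **`SU(2)`, `ℤ⁴`, `β_W = 1/16` + ALL plaquette-pair couplings `τ (1/10)^{‖x_p−x_q‖₁}(Re tr U_p/2)(Re tr U_q/2)`,
`|τ| ≤ 1/10000` (INFINITE RANGE): the ONE DLR STATE IS INVARIANT UNDER ALL `24` AXIS PERMUTATIONS.** [folklore] -/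
theorem su2_isotropicPair_oneState_permInvariant {τ : ℝ} (hτ : |τ| ≤ 1 / 10000) :
    ∃ μ : Measure (LGConfig 4 (SUN 2)),
      perturbedGibbsMeasuresS (d := 4) (fundamentalRep (Fin 2)) (((2 : ℕ) : ℝ) * ((1 / 16 : ℝ) / 4))
          (isotropicPairWitness (d := 4) 2 τ (1 / 10)) = {μ} ∧ ∀ π : Equiv.Perm (Fin 4), μ.map (configPermZd π) = μ := by
  have hmem := memBallZdS_isotropicPairWitness (d := 4) (N := 2) (τ := τ) (κ := 1 / 10) (t := 0)
    (by norm_num) (by norm_num) (by norm_num) (by norm_num) le_rfl (by rw [Real.exp_zero]; norm_num)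
  obtain ⟨B, hB⟩ := hmem.summable
  exact oneState_permInvariant_of_perturbedMassGapAtS (su2_isotropicPair_massGapS_1_16 hτ) hB hmem.continuous
    hmem.dependsOn (fun π X U => isotropicPairWitness_perm τ _ π X U)

/-- ★★ **Every `N ≥ 2`, `ℤ⁴`, 't Hooft `1/64` + the isotropic pair member, `|τ| ≤ 1/12000`: the one DLR state is invariant under
all axis permutations.** [folklore] -/
theorem suN_isotropicPair_oneState_permInvariant (hN : 2 ≤ N) {τ : ℝ} (hτ : |τ| ≤ 1 / 12000) :
    ∃ μ : Measure (LGConfig 4 (SUN N)),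
      perturbedGibbsMeasuresS (d := 4) (fundamentalRep (Fin N)) ((N : ℝ) * (1 / 64))
          (isotropicPairWitness (d := 4) N τ (1 / 10)) = {μ} ∧ ∀ π : Equiv.Perm (Fin 4), μ.map (configPermZd π) = μ := by
  have hmem := memBallZdS_isotropicPairWitness (d := 4) (N := N) (τ := τ) (κ := 1 / 10) (t := 0)
    (by norm_num) (by omega) (by norm_num) (by norm_num) le_rfl (by rw [Real.exp_zero]; norm_num)
  obtain ⟨B, hB⟩ := hmem.summable
  exact oneState_permInvariant_of_perturbedMassGapAtS (suN_isotropicPair_massGapS_1_64 hN hτ) hB hmem.continuous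
    hmem.dependsOn (fun π X U => isotropicPairWitness_perm τ _ π X U)

end Pairs

end Summit.Ventures.YMGap.RobustBall

end
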